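import Mathlib.Geometry.Manifold.ContMDiff.NormedSpace
import Literature.AlgebraicTopology.SingularHomology.Subdivision
import Literature.AlgebraicTopology.SingularHomology.LocalHomology
import HarnessLib

/-!
# Smooth singular simplices and the subcomplex of smooth singular chains

First brick of the integration proof of **de Rham's theorem** (de Rham 1931; Bredon,
*Topology and Geometry* (1993), §V.5 and §V.9; Lee, *Introduction to Smooth Manifolds* (2013),
Ch. 18; Warner (1983), 4.17 and 5.31–5.36): the smooth singular chains of a `C^∞` manifold.

Let `M` be a manifold modelled on a model with corners `I` (on the normed space `E`). A singular
`n`-simplex `σ : Δⁿ → M` (`Literature.AlgebraicTopology.SingularHomology.SingularSimplex`, with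
`Δⁿ = stdSimplex ℝ (Fin (n + 1)) ⊆ ℝⁿ⁺¹`) is **smooth** when it is `C^∞` *within the closed simplex*
in the sense of manifolds with corners: its barycentric extension
`SingularSimplex.bext σ : (Fin (n + 1) → ℝ) → M` (`σ` on `Δⁿ`, the value at the vertex `e₀`
elsewhere) is `ContMDiffOn 𝓘(ℝ, Fin (n + 1) → ℝ) I ∞ _ Δⁿ` (`SingularSimplex.IsSmooth`). This is
Lee's definition (2013, p. 473: "smooth in the sense that it has a smooth extension to a
neighbourhood of each point", here phrased with `ContMDiffWithinAt`, which only depends on the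
values on `Δⁿ`), it is choice-free, and it behaves well for manifolds with boundary.

Main results (all proved, no named facts):

* `SingularSimplex.IsSmooth.of_comp_contDiff`: precomposition with the restriction of a `C^∞` map
  `ℝᵐ⁺¹ → ℝⁿ⁺¹` sending `Δᵐ` into `Δⁿ` preserves smoothness; whence smoothness is preserved by
  affine reparametrisation `σ ∘ [w₀, …, wₖ]` (`IsSmooth.compose`), by faces (`IsSmooth.face`), by
  push-forward along `C^∞` maps (`IsSmooth.map`); `0`-simplices and constant simplices are smooth;
* `smoothChains I R A M n ⊆ Cₙ(M; A)`: the chains supported on smooth simplices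
  (`Finsupp.supported`), a subcomplex `smoothSub I R A M` of the concrete singular chain complex
  `csingularChainComplex R A M` (Bredon (1993), §V.5, `Δ_*^{smooth}(M)`), stable under the
  barycentric subdivision operators `S`, `T`, `Sʲ`, `Dⱼ` of `…Subdivision`
  (`sdX_mem_smoothChains`, `sdhX_mem_smoothChains`, `sdX_pow_mem_smoothChains`,
  `sdhSum_mem_smoothChains`) and under push-forward along `C^∞` maps
  (`mapDomain_mem_smoothChains`);
* `smoothChainsInSub I R A M U = smoothSub ⊓ chainsInSub U`: smooth chains with image in `U`, with
  `smoothChainsInSub (U ∩ V) = smoothChainsInSub U ⊓ smoothChainsInSub V`.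

The small-chains theorem, Mayer–Vietoris and the comparison with all singular chains are in the
sequel files.

## References

* G. E. Bredon, *Topology and Geometry*, GTM 139 (1993), §V.5, §V.9.
* J. M. Lee, *Introduction to Smooth Manifolds*, 2nd ed., GTM 218 (2013), Ch. 18, pp. 473–480.
* F. W. Warner, *Foundations of Differentiable Manifolds and Lie Groups*, GTM 94 (1983), 4.17.
-/

noncomputable section

open scoped Manifold ContDiff
open Set Literature.AlgebraicTopology.SingularHomology

universe u v

namespace Literature.AlgebraicTopology.SingularHomology.SingularSimplex

/-! ### The barycentric extension of a singular simplex -/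

variable {X : Type u} [TopologicalSpace X] {Y : Type u} [TopologicalSpace Y] {n m : ℕ}

open Classical in
/-- The **barycentric extension** of a singular `n`-simplex `σ : Δⁿ → X` to all of `ℝⁿ⁺¹`:
`σ` on the standard simplex `Δⁿ = stdSimplex ℝ (Fin (n + 1))`, and the (irrelevant) value
`σ(e₀)` elsewhere. Only its values on `Δⁿ` matter (`bext_apply_of_mem`). Dot-notation extension of
`Literature.AlgebraicTopology.SingularHomology.SingularSimplex`, declared from
`Literature/Geometry/Manifold`. [folklore] -/
def bext (σ : SingularSimplex X n) : (Fin (n + 1) → ℝ) → X := fun x ↦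
  if hx : x ∈ stdSimplex ℝ (Fin (n + 1)) then toContinuousMap σ ⟨x, hx⟩
  else toContinuousMap σ (stdSimplex.vertex 0)

/-- On the standard simplex the barycentric extension is the simplex. [folklore] -/
@[simp]
theorem bext_apply_of_mem (σ : SingularSimplex X n) {x : Fin (n + 1) → ℝ}
    (hx : x ∈ stdSimplex ℝ (Fin (n + 1))) : σ.bext x = toContinuousMap σ ⟨x, hx⟩ :=
  dif_pos hx

/-- Off the standard simplex the barycentric extension is the value at the vertex `e₀`. [folklore] -/
theorem bext_apply_of_notMem (σ : SingularSimplex X n) {x : Fin (n + 1) → ℝ}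
    (hx : x ∉ stdSimplex ℝ (Fin (n + 1))) : σ.bext x = toContinuousMap σ (stdSimplex.vertex 0) :=
  dif_neg hx

/-- On points of `Δⁿ` (as a subtype) the barycentric extension is the simplex. [folklore] -/
@[simp]
theorem bext_coe (σ : SingularSimplex X n) (t : StdSimplex n) : σ.bext t.1 = toContinuousMap σ t :=
  bext_apply_of_mem σ t.2

/-- On points of `Δⁿ` (coerced as functions) the barycentric extension is the simplex. [folklore] -/
@[simp]
theorem bext_coeFn (σ : SingularSimplex X n) (t : StdSimplex n) : σ.bext ⇑t = toContinuousMap σ t :=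
  bext_apply_of_mem σ t.2

/-- The restriction of the barycentric extension to `Δⁿ` is the simplex. [folklore] -/
theorem restrict_bext (σ : SingularSimplex X n) :
    (stdSimplex ℝ (Fin (n + 1))).restrict σ.bext = toContinuousMap σ := by
  funext t
  exact bext_coe σ t

/-- The barycentric extension is continuous on `Δⁿ`. [folklore] -/
theorem continuousOn_bext (σ : SingularSimplex X n) :
    ContinuousOn σ.bext (stdSimplex ℝ (Fin (n + 1))) := by
  rw [continuousOn_iff_continuous_restrict, restrict_bext]
  exact (toContinuousMap σ).continuous

/-- The image of a simplex is the image of `Δⁿ` under the barycentric extension. [folklore] -/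
theorem range_eq_image_bext (σ : SingularSimplex X n) :
    σ.range = σ.bext '' stdSimplex ℝ (Fin (n + 1)) := by
  ext y
  constructor
  · rintro ⟨t, rfl⟩
    exact ⟨t, t.2, bext_coe σ t⟩
  · rintro ⟨x, hx, rfl⟩
    exact ⟨⟨x, hx⟩, (bext_apply_of_mem σ hx).symm⟩

/-- The barycentric extension maps `Δⁿ` into the image of the simplex. [folklore] -/
theorem mapsTo_bext_range (σ : SingularSimplex X n) :
    MapsTo σ.bext (stdSimplex ℝ (Fin (n + 1))) σ.range := by
  rw [range_eq_image_bext]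
  exact mapsTo_image _ _

/-- Barycentric extension commutes with push-forward: `(f ∘ σ)~ = f ∘ σ~`. [folklore] -/
theorem bext_map (f : C(X, Y)) (σ : SingularSimplex X n) : (σ.map f).bext = f ∘ σ.bext := by
  funext x
  by_cases hx : x ∈ stdSimplex ℝ (Fin (n + 1))
  · rw [bext_apply_of_mem _ hx, Function.comp_apply, bext_apply_of_mem _ hx, toContinuousMap_map]
    rfl
  · rw [bext_apply_of_notMem _ hx, Function.comp_apply, bext_apply_of_notMem _ hx,
      toContinuousMap_map]
    rfl

/-- The barycentric extension of a `0`-simplex is constant. [folklore] -/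
theorem bext_eq_const_of_zero (σ : SingularSimplex X 0) :
    σ.bext = fun _ ↦ toContinuousMap σ default := by
  funext x
  by_cases hx : x ∈ stdSimplex ℝ (Fin 1)
  · rw [bext_apply_of_mem _ hx, Subsingleton.elim (⟨x, hx⟩ : StdSimplex 0) default]
  · rw [bext_apply_of_notMem _ hx, Subsingleton.elim (stdSimplex.vertex 0 : StdSimplex 0) default]

/-- The barycentric extension of `σ ∘ [w]` on `Δᵏ` is `σ~` of the affine combination. [folklore] -/
theorem bext_compose_apply_of_mem {k : ℕ} (σ : SingularSimplex X n) (w : Fin (k + 1) → StdSimplex n)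
    {x : Fin (k + 1) → ℝ} (hx : x ∈ stdSimplex ℝ (Fin (k + 1))) :
    (σ.compose w).bext x = σ.bext (∑ j, x j • ((w j : StdSimplex n) : Fin (n + 1) → ℝ)) := by
  have hmem : (∑ j, x j • ((w j : StdSimplex n) : Fin (n + 1) → ℝ)) ∈ stdSimplex ℝ (Fin (n + 1)) :=
    (StdSimplex.affComb w ⟨x, hx⟩).2
  rw [bext_apply_of_mem _ hx, bext_apply_of_mem _ hmem, toContinuousMap_compose]
  rfl

/-! ### Smooth singular simplices -/

variable {E : Type*} [NormedAddCommGroup E] [NormedSpace ℝ E]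
  {H : Type*} [TopologicalSpace H] (I : ModelWithCorners ℝ E H)
  {M : Type u} [TopologicalSpace M] [ChartedSpace H M]
  {E' : Type*} [NormedAddCommGroup E'] [NormedSpace ℝ E']
  {H' : Type*} [TopologicalSpace H'] (I' : ModelWithCorners ℝ E' H')
  {N : Type u} [TopologicalSpace N] [ChartedSpace H' N]

/-- A singular `n`-simplex `σ : Δⁿ → M` of a manifold is **smooth** if it is `C^∞` within the
closed standard simplex `Δⁿ ⊆ ℝⁿ⁺¹` in the sense of manifolds with corners: its barycentric
extension is `ContMDiffOn 𝓘(ℝ, ℝⁿ⁺¹) I ∞` on `Δⁿ` (this only depends on `σ`, since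
`ContMDiffWithinAt` only sees the values on the set). Lee (2013), p. 473 (smooth singular
simplices: smooth extension near each point of `Δᵖ`); Bredon (1993), §V.5; Warner (1983), 4.17.
Dot-notation extension of `…SingularSimplex`, declared from `Literature/Geometry/Manifold`.
[cite: LeeSmoothManifolds2013, Ch. 18 p. 473] -/
def IsSmooth (σ : SingularSimplex M n) : Prop :=
  ContMDiffOn 𝓘(ℝ, Fin (n + 1) → ℝ) I ∞ σ.bext (stdSimplex ℝ (Fin (n + 1)))

variable {I I'}

/-- **Smoothness is preserved by `C^∞` reparametrisations of the standard simplex**: if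
`τ = σ ∘ L|Δᵐ` for a `C^∞` map `L : ℝᵐ⁺¹ → ℝⁿ⁺¹` with `L(Δᵐ) ⊆ Δⁿ` and `σ` is smooth, so is `τ`
(chain rule within sets; Lee (2013), proof of Prop. 18.8 / p. 474). [cite: LeeSmoothManifolds2013, Ch. 18 p. 474] -/
theorem IsSmooth.of_comp_contDiff {σ : SingularSimplex M n} (hσ : σ.IsSmooth I)
    {L : (Fin (m + 1) → ℝ) → (Fin (n + 1) → ℝ)} (hL : ContDiff ℝ ∞ L)
    (hmaps : MapsTo L (stdSimplex ℝ (Fin (m + 1))) (stdSimplex ℝ (Fin (n + 1))))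
    {τ : SingularSimplex M m} (hτ : ∀ (x : Fin (m + 1) → ℝ) (hx : x ∈ stdSimplex ℝ (Fin (m + 1))),
      τ.bext x = σ.bext (L x)) :
    τ.IsSmooth I := by
  have h : ContMDiffOn 𝓘(ℝ, Fin (m + 1) → ℝ) I ∞ (σ.bext ∘ L) (stdSimplex ℝ (Fin (m + 1))) :=
    hσ.comp hL.contMDiff.contMDiffOn hmaps
  exact h.congr fun x hx ↦ hτ x hx

/-- **Affine reparametrisations of a smooth simplex are smooth**: `σ ∘ [w₀, …, wₖ]`
(`SingularSimplex.compose`) is smooth when `σ` is — the map `x ↦ ∑ⱼ xⱼ wⱼ` is linear, hence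
`C^∞`, and sends `Δᵏ` into `Δⁿ`. This covers faces, degeneracies and all the simplices produced
by barycentric subdivision (Bredon (1993), §V.5; Lee (2013), p. 474). [cite: LeeSmoothManifolds2013, Ch. 18 p. 474] -/
theorem IsSmooth.compose {k : ℕ} {σ : SingularSimplex M n} (hσ : σ.IsSmooth I)
    (w : Fin (k + 1) → StdSimplex n) : (σ.compose w).IsSmooth I := by
  refine hσ.of_comp_contDiff (L := fun x ↦ ∑ j, x j • ((w j : StdSimplex n) : Fin (n + 1) → ℝ))
    ?_ ?_ fun x hx ↦ bext_compose_apply_of_mem σ w hx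
  · exact ContDiff.sum fun j _ ↦ (contDiff_apply ℝ ℝ j).smul contDiff_const
  · intro x hx
    exact (StdSimplex.affComb w ⟨x, hx⟩).2

/-- **Faces of a smooth simplex are smooth** (Bredon (1993), §V.5: `Δ_*^{smooth}(M)` is a
subcomplex; Lee (2013), p. 474). [cite: LeeSmoothManifolds2013, Ch. 18 p. 474] -/
theorem IsSmooth.face {σ : SingularSimplex M (n + 1)} (hσ : σ.IsSmooth I) (i : Fin (n + 2)) :
    (σ.face i).IsSmooth I := by
  rw [face_eq_compose]
  exact hσ.compose _

/-- **Push-forward along a `C^∞` map preserves smoothness of simplices** (Lee (2013), p. 474: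
`F ∘ σ` is smooth; Bredon (1993), §V.5). [cite: LeeSmoothManifolds2013, Ch. 18 p. 474] -/
theorem IsSmooth.map [IsManifold I ∞ M] [IsManifold I' ∞ N] {σ : SingularSimplex M n}
    (hσ : σ.IsSmooth I) {f : M → N} (hf : ContMDiff I I' ∞ f) :
    (σ.map ⟨f, hf.continuous⟩).IsSmooth I' := by
  rw [IsSmooth, bext_map]
  exact hf.comp_contMDiffOn hσ

/-- A simplex with constant parametrisation is smooth. [folklore] -/
theorem isSmooth_of_forall_eq {σ : SingularSimplex M n} (p : M) (h : ∀ t, toContinuousMap σ t = p) :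
    σ.IsSmooth I := by
  have hb : σ.bext = fun _ ↦ p := by
    funext x
    by_cases hx : x ∈ stdSimplex ℝ (Fin (n + 1))
    · rw [bext_apply_of_mem _ hx, h]
    · rw [bext_apply_of_notMem _ hx, h]
  rw [IsSmooth, hb]
  exact contMDiffOn_const

/-- Every singular `0`-simplex is smooth. [folklore] -/
theorem isSmooth_of_zero (σ : SingularSimplex M 0) : σ.IsSmooth I :=
  isSmooth_of_forall_eq (toContinuousMap σ default) fun t ↦ by rw [Subsingleton.elim t default]

/-- A smooth simplex is continuous on `Δⁿ` as a map of `ℝⁿ⁺¹` (trivial, recorded for the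
integration files). [folklore] -/
theorem IsSmooth.continuousOn {σ : SingularSimplex M n} (_hσ : σ.IsSmooth I) :
    ContinuousOn σ.bext (stdSimplex ℝ (Fin (n + 1))) :=
  continuousOn_bext σ

end Literature.AlgebraicTopology.SingularHomology.SingularSimplex

namespace Literature.Geometry.Manifold

variable {E : Type*} [NormedAddCommGroup E] [NormedSpace ℝ E]
  {H : Type*} [TopologicalSpace H] (I : ModelWithCorners ℝ E H)
  (R : Type v) [CommRing R] (A : Type v) [AddCommGroup A] [Module R A]
  (M : Type u) [TopologicalSpace M] [ChartedSpace H M]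
  {E' : Type*} [NormedAddCommGroup E'] [NormedSpace ℝ E']
  {H' : Type*} [TopologicalSpace H'] {I' : ModelWithCorners ℝ E' H'}
  {N : Type u} [TopologicalSpace N] [ChartedSpace H' N]

/-! ### The set of smooth simplices and the submodule of smooth chains -/

/-- The set of smooth singular `n`-simplices of the manifold `M` (Bredon (1993), §V.5). [cite: Bredon1993, §V.5] -/
def smoothSimplices (n : ℕ) : Set (SingularSimplex M n) := {σ | σ.IsSmooth I}

variable {I M} in
/-- Membership in `smoothSimplices`. [folklore] -/
@[simp]
theorem mem_smoothSimplices_iff {n : ℕ} (σ : SingularSimplex M n) :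
    σ ∈ smoothSimplices I M n ↔ σ.IsSmooth I :=
  Iff.rfl

/-- **The smooth singular `n`-chains** `Δₙ^{smooth}(M; A) ⊆ Cₙ(M; A)`: concrete singular chains
supported on smooth simplices (Bredon (1993), §V.5; Lee (2013), p. 474, `C_p^∞(M)`).
[cite: Bredon1993, §V.5] -/
def smoothChains (n : ℕ) : Submodule R (CChain A M n) :=
  Finsupp.supported A R (smoothSimplices I M n)

variable {I R A M}

/-- Membership in `smoothChains`: every simplex of the chain is smooth. [folklore] -/
theorem mem_smoothChains_iff {n : ℕ} (c : CChain A M n) :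
    c ∈ smoothChains I R A M n ↔ ∀ σ ∈ c.support, σ.IsSmooth I := by
  rw [smoothChains, Finsupp.mem_supported]
  exact ⟨fun h σ hσ ↦ h hσ, fun h σ hσ ↦ h σ hσ⟩

/-- An elementary chain `a • σ` on a smooth simplex is a smooth chain. [folklore] -/
theorem single_mem_smoothChains {n : ℕ} {σ : SingularSimplex M n} (hσ : σ.IsSmooth I) (a : A) :
    Finsupp.single σ a ∈ smoothChains I R A M n :=
  Finsupp.single_mem_supported R a hσ

/-- **The boundary of a smooth chain is smooth** (faces of smooth simplices are smooth;
Bredon (1993), §V.5). [cite: Bredon1993, §V.5] -/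
theorem bd_mem_smoothChains {n : ℕ} {c : CChain A M (n + 1)} (hc : c ∈ smoothChains I R A M (n + 1)) :
    csingularChainComplex.bd R n c ∈ smoothChains I R A M n := by
  rw [← Finsupp.sum_single c, Finsupp.sum, map_sum]
  refine Submodule.sum_mem _ fun σ hσ => ?_
  rw [csingularChainComplex.bd_single]
  refine Submodule.sum_mem _ fun i _ => Submodule.smul_mem _ _ (single_mem_smoothChains ?_ _)
  exact ((mem_smoothChains_iff c).mp hc σ hσ).face i

variable (I R A M) in
/-- **The subcomplex of smooth singular chains** `Δ_•^{smooth}(M; A) ⊆ C_•(M; A)` of the concrete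
singular chain complex (Bredon (1993), §V.5; Lee (2013), p. 474). [cite: Bredon1993, §V.5] -/
def smoothSub : Subcomplex (csingularChainComplex R A M) where
  carrier n := smoothChains I R A M n
  d_mem' hx := d_mem_of_bd_mem R A (fun n => smoothChains I R A M n)
    (fun _ _ hc => bd_mem_smoothChains hc) hx

/-- `smoothSub` in a degree is `smoothChains`. [folklore] -/
@[simp]
theorem smoothSub_apply (n : ℕ) : smoothSub I R A M n = smoothChains I R A M n := rfl

/-- Realized tuple chains against a smooth simplex are smooth chains (all their simplices are
affine reparametrisations `σ ∘ [w]`). [folklore] -/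
theorem realize_mem_smoothChains {n k : ℕ} {σ : SingularSimplex M n} (hσ : σ.IsSmooth I)
    (c : TupleChain (StdSimplex n) k) (a : A) : realize R A σ k c a ∈ smoothChains I R A M k :=
  realize_mem_of_forall _ fun w _ ↦ single_mem_smoothChains (hσ.compose w) a

/-- **Barycentric subdivision `S` preserves smooth chains** (Bredon (1993), §V.5 / proof of
Thm. V.9.5: the subdivision operators are built from affine simplices). [cite: Bredon1993, §V.5] -/
theorem sdX_mem_smoothChains {n : ℕ} {c : CChain A M n} (hc : c ∈ smoothChains I R A M n) :
    sdX R A n c ∈ smoothChains I R A M n := by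
  rw [← Finsupp.sum_single c, Finsupp.sum, map_sum]
  refine Submodule.sum_mem _ fun σ hσ => ?_
  rw [sdX_single]
  exact realize_mem_smoothChains ((mem_smoothChains_iff c).mp hc σ hσ) _ _

/-- The operator `T` preserves smooth chains. [cite: Bredon1993, §V.5] -/
theorem sdhX_mem_smoothChains {n : ℕ} {c : CChain A M n} (hc : c ∈ smoothChains I R A M n) :
    sdhX R A n c ∈ smoothChains I R A M (n + 1) := by
  rw [← Finsupp.sum_single c, Finsupp.sum, map_sum]
  refine Submodule.sum_mem _ fun σ hσ => ?_
  rw [sdhX_single]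
  exact realize_mem_smoothChains ((mem_smoothChains_iff c).mp hc σ hσ) _ _

/-- Iterated subdivision `Sʲ` preserves smooth chains. [cite: Bredon1993, §V.5] -/
theorem sdX_pow_mem_smoothChains {n : ℕ} (j : ℕ) {c : CChain A M n} (hc : c ∈ smoothChains I R A M n) :
    ((sdX R A n) ^ j) c ∈ smoothChains I R A M n := by
  induction j with
  | zero => simpa using hc
  | succ j ih => rw [pow_succ', Module.End.mul_apply]; exact sdX_mem_smoothChains ih

/-- The chain homotopy `Dⱼ = ∑_{i<j} T Sⁱ` preserves smooth chains. [cite: Bredon1993, §V.5] -/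
theorem sdhSum_mem_smoothChains {n : ℕ} (j : ℕ) {c : CChain A M n} (hc : c ∈ smoothChains I R A M n) :
    sdhSum R A j n c ∈ smoothChains I R A M (n + 1) := by
  simp only [sdhSum, LinearMap.sum_apply, LinearMap.comp_apply]
  exact Submodule.sum_mem _ fun i _ => sdhX_mem_smoothChains (sdX_pow_mem_smoothChains i hc)

/-- **Push-forward along a `C^∞` map preserves smooth chains** (Lee (2013), p. 474,
`F_♯ : C_p^∞(M) → C_p^∞(N)`). [cite: LeeSmoothManifolds2013, Ch. 18 p. 474] -/
theorem mapDomain_mem_smoothChains [IsManifold I ∞ M] [IsManifold I' ∞ N] {f : M → N}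
    (hf : ContMDiff I I' ∞ f) {n : ℕ} {c : CChain A M n} (hc : c ∈ smoothChains I R A M n) :
    Finsupp.mapDomain (fun σ : SingularSimplex M n => σ.map ⟨f, hf.continuous⟩) c ∈
      smoothChains I' R A N n := by
  rw [← Finsupp.sum_single c, Finsupp.sum, Finsupp.mapDomain_finsetSum]
  refine Submodule.sum_mem _ fun σ hσ => ?_
  rw [Finsupp.mapDomain_single]
  exact single_mem_smoothChains (((mem_smoothChains_iff c).mp hc σ hσ).map hf) _

/-- The chain map `f♯` of a `C^∞` map sends the smooth subcomplex into the smooth subcomplex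
(as an inequality of subcomplexes, `smoothSub M ≤ (smoothSub N).comap f♯`). [cite: LeeSmoothManifolds2013, Ch. 18 p. 474] -/
theorem smoothSub_le_comap_map [IsManifold I ∞ M] [IsManifold I' ∞ N] {f : M → N}
    (hf : ContMDiff I I' ∞ f) :
    smoothSub I R A M ≤
      (smoothSub I' R A N).comap (csingularChainComplex.map R A ⟨f, hf.continuous⟩) := by
  intro n c hc
  change (csingularChainComplex.map R A ⟨f, hf.continuous⟩).f n c ∈ smoothChains I' R A N n
  rw [csingularChainComplex.map_f_apply]
  exact mapDomain_mem_smoothChains hf hc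

/-! ### Smooth chains with image in a subset -/

variable (I R A M) in
/-- **Smooth chains with image in `U`**: the subcomplex `Δ_•^{smooth}(U) = Δ_•^{smooth}(M) ⊓ C_•(U)`
of smooth chains all of whose simplices have image in `U ⊆ M` (Bredon (1993), §V.9, the
functor `U ↦ Δ_*^{smooth}(U)` on open subsets). [cite: Bredon1993, §V.9] -/
def smoothChainsInSub (U : Set M) : Subcomplex (csingularChainComplex R A M) :=
  smoothSub I R A M ⊓ chainsInSub R A M U

/-- Membership in `smoothChainsInSub U`: smooth, and with image in `U`. [folklore] -/
theorem mem_smoothChainsInSub_iff (U : Set M) (n : ℕ) (c : (csingularChainComplex R A M).X n) :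
    c ∈ smoothChainsInSub I R A M U n ↔ c ∈ smoothChains I R A M n ∧ c ∈ chainsIn R A M U n :=
  Iff.rfl

/-- `smoothChainsInSub` is monotone in the subset. [folklore] -/
theorem smoothChainsInSub_mono {U V : Set M} (h : U ⊆ V) :
    smoothChainsInSub I R A M U ≤ smoothChainsInSub I R A M V :=
  inf_le_inf_left _ (chainsInSub_mono R A h)

/-- `smoothChainsInSub U ≤ smoothSub`. [folklore] -/
theorem smoothChainsInSub_le_smoothSub (U : Set M) : smoothChainsInSub I R A M U ≤ smoothSub I R A M :=
  inf_le_left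

/-- `smoothChainsInSub U ≤ chainsInSub U`. [folklore] -/
theorem smoothChainsInSub_le_chainsInSub (U : Set M) :
    smoothChainsInSub I R A M U ≤ chainsInSub R A M U :=
  inf_le_right

/-- `Δ^{smooth}(univ) = Δ^{smooth}(M)`. [folklore] -/
@[simp]
theorem smoothChainsInSub_univ : smoothChainsInSub I R A M univ = smoothSub I R A M := by
  rw [smoothChainsInSub, chainsInSub_univ, inf_top_eq]

/-- `Δ^{smooth}(U ∩ V) = Δ^{smooth}(U) ⊓ Δ^{smooth}(V)`. [folklore] -/
theorem smoothChainsInSub_inter (U V : Set M) :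
    smoothChainsInSub I R A M (U ∩ V) = smoothChainsInSub I R A M U ⊓ smoothChainsInSub I R A M V := by
  rw [smoothChainsInSub, chainsInSub_inter, smoothChainsInSub, smoothChainsInSub, inf_inf_inf_comm,
    inf_idem]

/-- `Δ^{smooth}(U) ⊔ Δ^{smooth}(V) ≤ Δ^{smooth}(U ∪ V)`. [folklore] -/
theorem smoothChainsInSub_sup_le (U V : Set M) :
    smoothChainsInSub I R A M U ⊔ smoothChainsInSub I R A M V ≤ smoothChainsInSub I R A M (U ∪ V) :=
  sup_le (smoothChainsInSub_mono subset_union_left) (smoothChainsInSub_mono subset_union_right)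

/-- An elementary chain on a smooth simplex with image in `U` lies in `Δ^{smooth}(U)`. [folklore] -/
theorem single_mem_smoothChainsInSub {U : Set M} {n : ℕ} {σ : SingularSimplex M n}
    (hσ : σ.IsSmooth I) (hU : σ.range ⊆ U) (a : A) :
    Finsupp.single σ a ∈ smoothChainsInSub I R A M U n :=
  ⟨single_mem_smoothChains hσ a, single_mem_chainsIn R A hU a⟩

/-- The chain map of a `C^∞` map `f` with `f(U) ⊆ V` sends `Δ^{smooth}(U)` into `Δ^{smooth}(V)`. [cite: LeeSmoothManifolds2013, Ch. 18 p. 474] -/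
theorem smoothChainsInSub_le_comap_map [IsManifold I ∞ M] [IsManifold I' ∞ N] {f : M → N}
    (hf : ContMDiff I I' ∞ f) {U : Set M} {V : Set N} (hUV : MapsTo f U V) :
    smoothChainsInSub I R A M U ≤
      (smoothChainsInSub I' R A N V).comap (csingularChainComplex.map R A ⟨f, hf.continuous⟩) := by
  intro n c hc
  refine ⟨smoothSub_le_comap_map hf n hc.1, ?_⟩
  change (csingularChainComplex.map R A ⟨f, hf.continuous⟩).f n c ∈ chainsIn R A N V n
  rw [csingularChainComplex.map_f_apply]
  exact mapDomain_mem_chainsIn R A _ hUV hc.2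

end Literature.Geometry.Manifold
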